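import Summits.BirchSwinnertonDyer.BirchSwinnertonDyer.Theorems.SignedLowerHalvesKobayashiLowerHalfLargeImageBSTWTwistT2bDegreeRoad
import Literature.NumberTheory.Automorphic.ShimuraCurveRibetTakahashiComponentOrders
import Literature.NumberTheory.EllipticCurves.PastenHeightBoundsLemma68Proofs
import Literature.NumberTheory.EllipticCurves.ShafarevichGoodReductionBadPlacesProofs
import HarnessLib

/-!
# Route `SignedLowerHalves`, crux `KobayashiLowerHalfLargeImage` (item stmt-BirchSwinnertonDyer-19001): the BSTW-TWIST
# SUB-FAMILY of class X7 — (ram) is an isogeny invariant when `E[p]` is irreducible, so T2b's degree road runs on the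
# OPTIMAL curve of the twist's class (cell `pub/bsd-litref`, paper sub-dir `bstw24`, prover seat `bsd-litref-bstw24-pv`
# gen 7; companion of `…BSTWTwistT2bDegreeRoad.lean` p512130; a `--supports … --as helper` file; THEOREMS ONLY; closes nothing)

HONEST FRAMING (programme BSD-LIT2PART v1 §HONESTY, verbatim): «no tranche here proves BSD; ARM L moves the LITERAL
column of an r ≤ 1 census into the kernel-proved-modulo-named-print column; ARM P changes what "named print" is
worth.» Burungale–Skinner–Tian–Wan arXiv:2409.01350v2 is an UNREFEREED PREPRINT and NOTHING of it is used below; the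
T2b theorem stays CONDITIONAL on the PUBLISHED named facts `hT` (Takahashi 2001 Thm. 2.3), `hARS` (Agashe–Ribet–Stein
2012 Thm. 2.1 (b)), `hmod` (modularity), `hLL` (Diamond 1995 / Ribet 1990). Records ≠ bookings; class X7 stays
CONSTRUCTION-SHAPED; crux 3 stays OPEN; 0 cells move; typed ≠ proved ≠ endorsed.

WHAT. `…BSTWTwistT2bDegreeRoad.lean` (`padicValNat_congruenceNumber_eq_xi_of_twistBody`) DISPLAYS one hypothesis it does
not discharge: the parametrisation datum of minimal degree is one OF the curve at hand, i.e. the theorem is about the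
`X₀(N_K)`-optimal curve of the twist's isogeny class, whereas the census model `W` of `E ≅ E₀^{(d)}` need not be optimal.
This file removes the gap CLASS-WIDE: at an odd good supersingular `p` the module `E[p]` is irreducible, isogenous curves
are then joined by an isogeny of degree prime to `p` (Ribet–Takahashi 1997 §1, tree theorem
`exists_isogeny_not_dvd_degree_of_hasIrreducibleModPGaloisRep`), and along such an isogeny a multiplicative place stays
multiplicative with `c_v(W)·b = c_v(W')·a`, `ab ∣ deg` (Pasten 2024 Lemma 6.8, tree theorem
`exists_ordMinimalDiscriminant_mul_eq_mul_of_degree_eq`) — so `p ∤ c_v` transports: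

* `ram_of_isogeny_of_not_dvd_degree` — `Ram W p → Ram W' p` along a `ℚ`-isogeny of degree prime to `p`; UNCONDITIONAL;
* `ram_of_isIsogenous_of_irr` — `Ram W p → Ram W' p` for `W ∼ W'` when `W[p]` is irreducible; UNCONDITIONAL;
* `padicValNat_congruenceNumber_eq_xi_of_isIsogenous_twistBody` — T2b's valuation identity `ord_p r_f = ord_p ξ_S(W'; N/q, q)`
  for EVERY curve `W'` isogenous to the twist `W` of a BODY twist datum (in particular the optimal one, whose
  minimal-degree parametrisation datum the statement quantifies over), at `W'`'s (ram) prime transported from `W`;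
  modulo `hT`, `hARS`, `hmod`, `hLL`. This is referee C4 ROUND C4-R3-ADD-11 (γ) / C4-R3-ADD-12 «T2b consumed form PASS
  by refereed print on road B1‴ for ALL 389 complement pairs, kernel carrier p509036 by name» composed in the kernel
  with the (ram) transport, optimality included.

Design: THEOREMS ONLY; default heartbeats; axioms standard.
References: [RibetTakahashi1997] §1; [PastenShimura2024] Lemma 6.8, Prop. 6.13; [SilvermanAEC2009] Cor. VII.7.2, VIII.8;
[PollackWeston2011] Thm. 6.8 (§6.5); [Takahashi2001] Thm. 2.3; [AgasheRibetStein2012] Thm. 2.1; [Serre1972] §1.11 Prop. 12.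
-/

set_option autoImplicit false
set_option linter.dupNamespace false

noncomputable section

open scoped Classical
open IsDedekindDomain IsDedekindDomain.HeightOneSpectrum Rat.HeightOneSpectrum WeierstrassCurve NumberField
  Literature.NumberTheory.EllipticCurves Literature.NumberTheory.EllipticCurves.ModularForms
  Literature.NumberTheory.Automorphic
  Literature.NumberTheory.EllipticCurves.Rank1Residual
  Literature.NumberTheory.EllipticCurves.BurungaleSkinnerTianWan2024
  Summit.BirchSwinnertonDyer.Rank1Residual.Supersingular

namespace Summit.BirchSwinnertonDyer.BirchSwinnertonDyer.Theorems.X7Twist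

section RamIsogeny

variable {W W' : WeierstrassCurve ℚ} [W.IsElliptic] [W.IsGloballyMinimal] [W'.IsElliptic] [W'.IsGloballyMinimal]
  (p : ℕ) [Fact p.Prime]

/-- **(ram) transports along a `ℚ`-isogeny of degree prime to `p`.** If `φ : W → W'` has `p ∤ deg φ` and `q ≠ p` is a
multiplicative prime of `W` with `p ∤ v_q(Δ_min(W))`, then `q` is multiplicative for `W'` (Silverman Cor. VII.7.2 via
`f_q = 1`) and `v_q(Δ_min(W))·b = v_q(Δ_min(W'))·a` with `ab ∣ deg φ` (Pasten 2024 Lemma 6.8, functoriality of the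
component groups), so `p ∤ v_q(Δ_min(W'))`. UNCONDITIONAL. [cite: PastenShimura2024, Lemma 6.8 and its proof]
[cite: SilvermanAEC2009, Cor. VII.7.2 and VIII.8] -/
theorem ram_of_isogeny_of_not_dvd_degree (φ : Isogeny W W') (hφ : ¬ p ∣ φ.degree) (hram : Ram W p) : Ram W' p := by
  have hp : p.Prime := Fact.out
  obtain ⟨q, hq, hqp, hmult, hval⟩ := hram
  have hqP : q.Prime := hq.out
  set v : HeightOneSpectrum ℤ := (primesEquiv (R := ℤ)).symm ⟨q, hqP⟩ with hvdef
  have hgen : natGenerator v = q := congrArg Subtype.val ((primesEquiv (R := ℤ)).apply_symm_apply ⟨q, hqP⟩)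
  have hmv : W.HasMultiplicativeReductionAt v :=
    (W.hasMultiplicativeReductionAtPrime_iff_hasMultiplicativeReductionAt_holds ⟨q, hqP⟩).mp hmult
  have hmv' : W'.HasMultiplicativeReductionAt v := hasMultiplicativeReductionAt_of_isIsogenous ⟨φ⟩ v hmv
  have hmult' : W'.HasMultiplicativeReductionAtPrime q :=
    (W'.hasMultiplicativeReductionAtPrime_iff_hasMultiplicativeReductionAt_holds ⟨q, hqP⟩).mpr hmv'
  obtain ⟨a, b, ha, hb, hab, heq⟩ := exists_ordMinimalDiscriminant_mul_eq_mul_of_degree_eq φ.degree φ rfl v hmv hmv'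
  -- bridge `padicValInt q Δ_min = ord_v Δ_min`
  have bridge : ∀ (X : WeierstrassCurve ℚ) [X.IsElliptic] [X.IsGloballyMinimal],
      padicValInt q X.minimalDiscriminantInt = X.ordMinimalDiscriminant v := by
    intro X _ _
    have h1 := X.factorization_minimalDiscriminantNorm_holds v
    rw [hgen, minimalDiscriminantNorm_int_eq_natAbs_minimalDiscriminantInt_holds X, Nat.factorization_def _ hqP] at h1
    rw [← h1]; rfl
  refine ⟨q, hq, hqp, hmult', ?_⟩
  rw [bridge W] at hval
  rw [bridge W']
  intro hdvd
  have hpa : ¬ p ∣ a := fun h ↦ hφ (dvd_trans h (dvd_trans (dvd_mul_right a b) hab))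
  have hpb : ¬ p ∣ b := fun h ↦ hφ (dvd_trans h (dvd_trans (dvd_mul_left b a) hab))
  have h1 : p ∣ W.ordMinimalDiscriminant v * b := by rw [heq]; exact dvd_mul_of_dvd_left hdvd a
  rcases (Nat.Prime.dvd_mul hp).mp h1 with h | h
  · exact hval h
  · exact hpb h

/-- **(ram) is a `ℚ`-isogeny invariant when `W[p]` is irreducible**: isogenous curves with `W[p]` irreducible are joined
by an isogeny of degree prime to `p` (Ribet–Takahashi 1997 §1; tree `exists_isogeny_not_dvd_degree_of_hasIrreducibleModPGaloisRep`),
and `ram_of_isogeny_of_not_dvd_degree` applies. UNCONDITIONAL. [cite: RibetTakahashi1997, §1 (paragraph preceding Thm. 1)]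
[cite: PastenShimura2024, Lemma 6.8] -/
theorem ram_of_isIsogenous_of_irr (h : IsIsogenous W W') (hirr : Irr W p) (hram : Ram W p) : Ram W' p := by
  obtain ⟨φ, hφ⟩ := exists_isogeny_not_dvd_degree_of_hasIrreducibleModPGaloisRep h (Fact.out) hirr
  exact ram_of_isogeny_of_not_dvd_degree p φ hφ hram

end RamIsogeny

section DegreeRoadOptimal

variable (W W' : WeierstrassCurve ℚ) [W.IsElliptic] [W.IsGloballyMinimal] [W'.IsElliptic] [W'.IsGloballyMinimal]
  (p : ℕ) [Fact p.Prime]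

/-- **T2b's valuation identity on ANY curve isogenous to the twist — in particular the `X₀(N_K)`-optimal one —
CLASS-WIDE for every BODY twist datum at every odd `p`.** For `W` the twist of a BODY datum and `W' ∼ W`: `W[p]` is
irreducible (good supersingular at the odd `p`, `hasIrreducibleModPGaloisRep_of_dvd_frobeniusTrace`), so `Ram W' p`
(`ram_of_isIsogenous_of_irr` ∘ `ram_of_twistBody`) and `p` is good for `W'` (Silverman Cor. VII.7.2); then
`padicValNat_congruenceNumber_eq_xi_of_ram` at `W'`: at `W'`'s (ram) prime `q`, `N_{W'} = M·q` and
`ord_p r_f = ord_p ξ_S(W'; M, q)` for every minimal-degree parametrisation datum of `W'` and every Brandt setup `S`.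
Modulo `hT`, `hARS`, `hmod`, `hLL` (PUBLISHED, by name). T2a and the `p = 3` tier untouched; closes nothing; 0 cells move.
[cite: PollackWeston2011, Thm. 6.8 (§6.5, case N⁻ = q)] [cite: Takahashi2001, Thm. 2.3 (p. 79)] [cite: AgasheRibetStein2012, Thm. 2.1]
[cite: RibetTakahashi1997, §1] [cite: PastenShimura2024, Lemma 6.8] [cite: Serre1972, §1.11 Prop. 12] -/
theorem padicValNat_congruenceNumber_eq_xi_of_isIsogenous_twistBody (hT : takahashi2001_thm_2_3_of_coprime)
    (hARS : padicValNat_congruenceNumber_eq_of_not_sq_dvd) (hmod : exists_isNewformOf)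
    (hLL : Literature.NumberTheory.Automorphic.diamond1995_refinedSerre) (hp2 : p ≠ 2)
    (htw : ∃ (W₀ : WeierstrassCurve ℚ) (_ : W₀.IsElliptic) (_ : W₀.IsGloballyMinimal) (d : ℤ) (C : VariableChange ℚ),
      Semistable W₀ ∧ GoodSS W₀ p ∧ W₀.frobeniusTrace p = 0 ∧ Squarefree d ∧ d ≠ 1 ∧
      (∀ (q : ℕ) [Fact q.Prime], RamifiedInQuadratic d q → q ≠ p ∧ W₀.HasGoodReductionAtPrime q) ∧
      C • W = W₀.quadraticTwist (d : ℚ)) (hiso : IsIsogenous W W') :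
    ∃ M q : ℕ, q.Prime ∧ q ≠ p ∧ M.Coprime q ∧ W'.conductorNorm ℤ = M * q ∧ Nonempty (Brandt.XiSetup M q) ∧
      ∀ [NeZero (W'.conductorNorm ℤ)] (P : ModularParametrizationData W' (W'.conductorNorm ℤ)),
        (∀ (W'' : WeierstrassCurve ℚ) [W''.IsElliptic] (P' : ModularParametrizationData W'' (W'.conductorNorm ℤ)),
          P'.f = P.f → P.modularDegree ≤ P'.modularDegree) →
        ∀ S : Brandt.XiSetup M q, padicValNat p (congruenceNumber P.f) = padicValNat p (S.xi fun n => W'.LFunction n) := by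
  have hG := goodSS_of_twistBody W p hp2 htw
  have hirr : Irr W p :=
    hasIrreducibleModPGaloisRep_of_dvd_frobeniusTrace W p hp2
      (W.not_dvd_minimalDiscriminantInt_of_hasGoodReductionAtPrime' p hG.1) hG.2
  have hram' : Ram W' p := ram_of_isIsogenous_of_irr p hiso hirr (ram_of_twistBody W p hmod hLL hp2 htw)
  have hgood' : W'.HasGoodReductionAtPrime p := by
    obtain ⟨v, hv⟩ : ∃ v : HeightOneSpectrum (𝓞 ℚ), (primesEquiv v : ℕ) = p :=
      ⟨primesEquiv.symm ⟨p, Fact.out⟩, by rw [Equiv.apply_symm_apply]⟩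
    subst hv
    exact (hasGoodReductionAtPrime_iff_hasGoodReductionAt_ringOfIntegers v W').mpr
      ((hiso.hasGoodReductionAt_iff_of_isIsogenous v).mp
        ((hasGoodReductionAtPrime_iff_hasGoodReductionAt_ringOfIntegers v W).mp hG.1))
  exact padicValNat_congruenceNumber_eq_xi_of_ram W' p hT hARS hram' hgood'

end DegreeRoadOptimal

end Summit.BirchSwinnertonDyer.BirchSwinnertonDyer.Theorems.X7Twist

end
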